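import Summits.CriticalPhenomena.PercolationContinuityZ3.Theorems.PercNearOneGluingNoHeavyLowerTailGeometricMomentCIL
import Summits.CriticalPhenomena.PercolationContinuityZ3.Theorems.PercNearOneGluingNoHeavyLowerTailCILSmall
import HarnessLib

/-!
# `NoHeavyLowerTail` (stmt-CriticalPhenomena-4575) — CIL with a COMMON witness at every level gives the geometric-moment CIL
# (Abel summation), hence GM-CIL(1) for `|A| ≤ 3`

Support file (lead gen 4; `--supports stmt-CriticalPhenomena-4575`).  No definitions, no named facts, no sorries.
Notation as in `…GeometricMomentCIL.lean` (`L(v) = Σ_{j≥1} v^j P(N=j)`, `R_a(v) = Σ_{j≥0} v^j P(|π(a)|=j)`).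

* `GeomMomentCIL.abel_lower` — summation by parts as an inequality: for an antitone nonnegative weight `a` and a sequence `e`
  whose partial sums are `≥ 0`, `a_k · Σ_{i≤k} e_i ≤ Σ_{i≤k} a_i e_i` (so the right side is `≥ 0`).
* `GeomMomentCIL.momentSum_le_of_commonWitness` — **if ONE relay `a` is a CIL witness at EVERY level**
  (`P(1 ≤ N ≤ j) ≤ P(|π(a)| ≤ j)` for `j = 1, …, |A|`) **then `L(v) ≤ R_a(v)` for every `v ∈ [0,1]`** (the hypothesis shape of
  `Theorems.noHeavyLowerTail_of_geometricMomentCIL` with `C = 1`).  The census of the lead memo (LEAD-GEN4 §5) shows a common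
  witness exists in all but ≈ 1e-4 of random instances — this lemma is the formal bridge for those classes where it does.
* `geometricMomentCIL_of_card_le_three` — **GM-CIL(1) for `|A| ≤ 3`, every graph, every `v`**: the lonely-relay champion
  (`Theorems.cumulativeIsolation_level_one`, Kozma–Nitzan Lemma 2) is a witness at level 1, and every relay is a witness at the
  levels `j ≥ |A| − 1` (`Theorems.cumulativeIsolation_level_ge`).  (For `|A| = 3` this is the uniform-star-sink case of
  Kozma–Nitzan's Theorem 3, obtained here without Lemma 4.)
-/

noncomputable section

namespace Summit.CriticalPhenomena.PercolationContinuityZ3.Theorems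

open MeasureTheory Set Literature.Probability.LatticeModels Literature.Probability.Percolation
open Summit.CriticalPhenomena.PercolationContinuityZ3.Theses.PercNearOneGluing
open scoped Classical BigOperators

namespace GeomMomentCIL

variable {n : ℕ}

/-- **Abel's inequality.**  If `a` is antitone and nonnegative and all partial sums `Σ_{i ≤ j} e_i` (`j ≤ k`) are `≥ 0`, then
`a_k · Σ_{i≤k} e_i ≤ Σ_{i≤k} a_i e_i`. -/
theorem abel_lower (a e : ℕ → ℝ) (ha : ∀ j, a (j + 1) ≤ a j) :
    ∀ k : ℕ, (∀ j ≤ k, 0 ≤ ∑ i ∈ Finset.range (j + 1), e i) →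
      a k * ∑ i ∈ Finset.range (k + 1), e i ≤ ∑ i ∈ Finset.range (k + 1), a i * e i := by
  intro k
  induction k with
  | zero => intro _; simp
  | succ k ih =>
      intro hD
      have hDk : 0 ≤ ∑ i ∈ Finset.range (k + 1), e i := hD k (Nat.le_succ k)
      have ih' := ih fun j hj => hD j (hj.trans (Nat.le_succ k))
      rw [Finset.sum_range_succ (fun i => a i * e i), Finset.sum_range_succ e, mul_add]
      have h1 : a (k + 1) * ∑ i ∈ Finset.range (k + 1), e i ≤ a k * ∑ i ∈ Finset.range (k + 1), e i :=
        mul_le_mul_of_nonneg_right (ha k) hDk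
      linarith

/-- **A common CIL witness at every level gives the geometric-moment inequality (constant `1`).**  For `ℕ`-valued
statistics `N, M ≤ k` on a probability space: if `μ{1 ≤ N ≤ j} ≤ μ{M ≤ j}` for every `1 ≤ j ≤ k`, then for `0 ≤ v ≤ 1`
`Σ_{j=1}^{k} v^j μ{N = j} ≤ Σ_{j=0}^{k} v^j μ{M = j}`. -/
theorem momentSum_le_of_commonWitness (μ : Measure (BondConfig (Fin n))) [IsProbabilityMeasure μ]
    (N M : BondConfig (Fin n) → ℕ) (k : ℕ) (v : ℝ) (hv0 : 0 ≤ v) (hv1 : v ≤ 1)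
    (hCIL : ∀ j, 1 ≤ j → j ≤ k →
      μ.real {ω : BondConfig (Fin n) | 1 ≤ N ω ∧ N ω ≤ j} ≤ μ.real {ω : BondConfig (Fin n) | M ω ≤ j}) :
    ∑ j ∈ Finset.Icc 1 k, v ^ j * μ.real {ω : BondConfig (Fin n) | N ω = j} ≤
      ∑ j ∈ Finset.range (k + 1), v ^ j * μ.real {ω : BondConfig (Fin n) | M ω = j} := by
  -- the two level sequences, the `N`-side one with its `j = 0` term removed
  set x : ℕ → ℝ := fun j => if 1 ≤ j then μ.real {ω : BondConfig (Fin n) | N ω = j} else 0 with hx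
  set y : ℕ → ℝ := fun j => μ.real {ω : BondConfig (Fin n) | M ω = j} with hy
  -- rewrite the left side over `range (k+1)`
  have hL : ∑ j ∈ Finset.Icc 1 k, v ^ j * μ.real {ω : BondConfig (Fin n) | N ω = j} =
      ∑ j ∈ Finset.range (k + 1), v ^ j * x j := by
    have hsplit : Finset.range (k + 1) = insert 0 (Finset.Icc 1 k) := by
      ext j; simp only [Finset.mem_range, Finset.mem_insert, Finset.mem_Icc]; omega
    rw [hsplit, Finset.sum_insert (by simp)]
    simp only [hx, show ¬ (1 ≤ 0) from by omega, if_false, mul_zero, zero_add]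
    refine Finset.sum_congr rfl fun j hj => ?_
    rw [if_pos (Finset.mem_Icc.1 hj).1]
  rw [hL]
  -- partial sums: `Σ_{i≤j} x_i = μ{1 ≤ N ≤ j}` and `Σ_{i≤j} y_i = μ{M ≤ j}`
  have hX : ∀ j, ∑ i ∈ Finset.range (j + 1), x i = μ.real {ω : BondConfig (Fin n) | 1 ≤ N ω ∧ N ω ≤ j} := by
    intro j
    have h1 : ∑ i ∈ Finset.range (j + 1), x i =
        ∑ i ∈ (Finset.range (j + 1)).filter (fun i => 1 ≤ i), μ.real {ω : BondConfig (Fin n) | N ω = i} := by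
      rw [Finset.sum_filter]
    rw [h1, sum_measureReal_level_eq μ N _]
    congr 1; ext ω
    simp only [Set.mem_setOf_eq, Finset.mem_filter, Finset.mem_range]
    omega
  have hY : ∀ j, ∑ i ∈ Finset.range (j + 1), y i = μ.real {ω : BondConfig (Fin n) | M ω ≤ j} := by
    intro j
    rw [show (∑ i ∈ Finset.range (j + 1), y i) =
        ∑ i ∈ Finset.range (j + 1), μ.real {ω : BondConfig (Fin n) | M ω = i} from rfl,
      sum_measureReal_level_eq μ M _]
    congr 1; ext ω
    simp only [Set.mem_setOf_eq, Finset.mem_range]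
    omega
  -- Abel with `e = y − x`: partial sums `μ{M ≤ j} − μ{1 ≤ N ≤ j} ≥ 0`
  have hD : ∀ j ≤ k, 0 ≤ ∑ i ∈ Finset.range (j + 1), (y i - x i) := by
    intro j hj
    rw [Finset.sum_sub_distrib, hX, hY]
    rcases Nat.eq_zero_or_pos j with rfl | hj1
    · -- level 0: the `N`-event is empty
      have h0 : {ω : BondConfig (Fin n) | 1 ≤ N ω ∧ N ω ≤ 0} = ∅ := by
        ext ω; simp only [Set.mem_setOf_eq, Set.mem_empty_iff_false, iff_false]; omega
      rw [h0, measureReal_empty, sub_zero]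
      exact measureReal_nonneg
    · linarith [hCIL j hj1 hj]
  have habel := abel_lower (fun j => v ^ j) (fun i => y i - x i)
    (fun j => by simpa [pow_succ] using mul_le_of_le_one_right (pow_nonneg hv0 j) hv1) k hD
  have hk0 : 0 ≤ (v ^ k) * ∑ i ∈ Finset.range (k + 1), (y i - x i) :=
    mul_nonneg (pow_nonneg hv0 k) (hD k le_rfl)
  have hsum : ∑ i ∈ Finset.range (k + 1), v ^ i * (y i - x i) =
      ∑ i ∈ Finset.range (k + 1), v ^ i * y i - ∑ i ∈ Finset.range (k + 1), v ^ i * x i := by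
    rw [← Finset.sum_sub_distrib]
    refine Finset.sum_congr rfl fun i _ => ?_
    ring
  have := hk0.trans habel
  rw [hsum] at this
  linarith

end GeomMomentCIL

open GeomMomentCIL in
/-- **GM-CIL(1) for `|A| ≤ 3` (every graph, every `v ∈ [0,1]`).**  The lonely-relay champion is a CIL witness at level 1
(`Theorems.cumulativeIsolation_level_one`) and every relay is a witness at levels `j ≥ |A| − 1`
(`Theorems.cumulativeIsolation_level_ge`); with `|A| ≤ 3` these are all levels, and `momentSum_le_of_commonWitness` concludes.
[this work] -/
theorem geometricMomentCIL_of_card_le_three {n : ℕ} (w : Sym2 (Fin n) → unitInterval)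
    (A : Finset (Fin n)) (o : Fin n) (v : ℝ) (hv0 : 0 ≤ v) (hv1 : v ≤ 1) (hA : A.Nonempty)
    (hA3 : A.card ≤ 3) :
    ∃ a ∈ A, ∑ j ∈ Finset.Icc 1 A.card, v ^ j * (prodBernoulli w).real {ω : BondConfig (Fin n) |
        (A.filter fun x => ω ∈ openConn o x).card = j} ≤
      ∑ j ∈ Finset.range (A.card + 1), v ^ j * (prodBernoulli w).real {ω : BondConfig (Fin n) |
        (A.filter fun x => ω ∈ openConn a x).card = j} := by
  obtain ⟨a, ha, h1⟩ := cumulativeIsolation_level_one w A o hA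
  refine ⟨a, ha, momentSum_le_of_commonWitness (prodBernoulli w)
    (fun ω => (A.filter fun x => ω ∈ openConn o x).card)
    (fun ω => (A.filter fun x => ω ∈ openConn a x).card) A.card v hv0 hv1 fun j hj1 hjk => ?_⟩
  rcases Nat.lt_or_ge j 2 with hj2 | hj2
  · -- level 1
    have hj : j = 1 := by omega
    subst hj
    exact h1
  · -- levels `j ≥ 2 ≥ |A| − 1`
    exact cumulativeIsolation_level_ge w A o a j (by omega)
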